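import Mathlib
import Summits.ABC.ABC.Statement

/-!
# Rung S5 — `(PL₁)`: polynomial radical growth of `y^B + 1` (solo-ABC-informed, session 11)

The report `paper/paper.md` §5 isolates, as the smallest open instance of Philippon's 2000 conjecture
`PL` (the door of the polynomial rung `(W)`, kernel file `SoloInformedPhilipponDoor.lean`), the statement

  `(PL₁)  ∃ λ > 0, C : ∀ y ≥ 1,  λ · log y ≤ log rad(y^B + 1) + C`   (one fixed exponent `B`).

This file places `(PL₁)` on the ladder with two kernel implications, both elementary:

* `soloInformed_PL1_linear_of_philippon`, `soloInformed_PL1_of_philippon`: Philippon's conjecture `PL`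
  (in exactly the hypothesis shape `hPL` of `SoloInformedPhilipponDoor.lean`, with its parameters
  `0 ≤ ε < 1/2`, `α, β ≥ 0`, `B ≥ 1`) implies `(1 − ε)·B·log y ≤ (αB + ε)(log rad(y^B+1) + β)` for every
  natural `y ≥ 1` — this is `PL` at `x = 1` — hence `(PL₁)` with `λ = (1 − ε)B/(αB + ε)`.
  [cite: Philippon2000Addendum, Conjecture, p. 167]
* `soloInformed_PL1_of_abc`: the abc conjecture implies, for every `B ≥ 1` and `ε > 0`,
  `(B − 1 − ε)·log y ≤ (1 + ε)·log rad(y^B + 1) + C` for all `y ≥ 1` (the abc-triple `1 + y^B = y^B + 1`,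
  `rad(y^B (y^B+1)) ≤ y · rad(y^B+1)`); this is Langevin's consequence of abc for the polynomial `t^B + 1`,
  exponent `B − 1 − ε'`. [cite: Langevin1993]

So `(PL₁)` is NECESSARY for the summit and for Philippon's door, and it is of `(F6)`-type (one thin family).
What is known unconditionally is exponentially weaker and is NOT formalised here (literature, effective):
`log rad(f(x)) ≥ c₇ · log₂|x| · log₃|x| / log₄|x|` for `f ∈ ℤ[X]` with two distinct roots
(Gross–Vincent 2013 with Matveev's bound and Stewart's 2008 arithmetic–geometric-mean step), as recorded in
Bugeaud–Evertse–Győry, Acta Arith. 184 (2018), §9 [arXiv:1708.08290, p. 20]. Mathlib + `Statement` only.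
-/

open Real Height UniqueFactorizationMonoid
open Literature.NumberTheory.DiophantineGeometry

namespace Summit.ABC.ABC.Theorems

/-! ### Small bookkeeping facts -/

/-- `rad(y^B · (y^B + 1)) ≤ y · rad(y^B + 1)` in `ℕ` for `y, B ≥ 1`. [folklore] -/
theorem soloInformed_radical_pow_mul_succ_le {y B : ℕ} (hy : 0 < y) (hB : 0 < B) :
    radical (y ^ B * (y ^ B + 1)) ≤ y * radical (y ^ B + 1) := by
  have h1 : radical (y ^ B * (y ^ B + 1)) ∣ radical (y ^ B) * radical (y ^ B + 1) :=
    radical_mul_dvd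
  have h2 : radical (y ^ B) = radical y := radical_pow y hB.ne'
  have h3 : radical y ≤ y := Nat.radical_le_self_iff.mpr hy.ne'
  have h4 : radical (y ^ B * (y ^ B + 1)) ≤ radical (y ^ B) * radical (y ^ B + 1) :=
    Nat.le_of_dvd (Nat.mul_pos (Nat.radical_pos _) (Nat.radical_pos _)) h1
  calc radical (y ^ B * (y ^ B + 1)) ≤ radical (y ^ B) * radical (y ^ B + 1) := h4
    _ = radical y * radical (y ^ B + 1) := by rw [h2]
    _ ≤ y * radical (y ^ B + 1) := Nat.mul_le_mul_right _ h3

/-- `B · log y ≤ log (y^B + 1)` for `y ≥ 1`. [folklore] -/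
theorem soloInformed_mul_log_le_log_pow_succ {y : ℕ} (hy : 0 < y) (B : ℕ) :
    (B : ℝ) * Real.log y ≤ Real.log (((y ^ B + 1 : ℕ) : ℝ)) := by
  have hy0 : (0 : ℝ) < y := by exact_mod_cast hy
  rw [← Real.log_pow]
  refine Real.log_le_log (pow_pos hy0 B) ?_
  push_cast
  linarith

/-! ### `PL ⟹ (PL₁)`: Philippon's conjecture at `x = 1` -/

/-- **`PL` at `x = 1` (linear form).** Under Philippon's conjecture `PL` with parameters
`0 ≤ ε`, `0 ≤ α`, `0 ≤ β`, `B ≥ 1` (hypothesis shape of `SoloInformedPhilipponDoor.lean`), every natural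
`y ≥ 1` satisfies `(1 − ε) · B · log y ≤ (αB + ε) · (log rad(y^B + 1) + β)`.
[cite: Philippon2000Addendum, Conjecture, p. 167] -/
theorem soloInformed_PL1_linear_of_philippon {ε α β : ℝ} {B : ℕ}
    (hPL : ∀ x y : ℚ, x ≠ 0 → y ≠ 0 → x * y ^ B + 1 ≠ 0 →
      Real.log (((x * y ^ B + 1).num.natAbs : ℕ) : ℝ) ≤
        (B : ℝ) * (α * logHeight₁ x + ε * logHeight₁ y) +
          (α * B + ε) *
            (Real.log ((radical (x * y ^ B + 1).num.natAbs : ℕ) : ℝ) + β))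
    {y : ℕ} (hy : 0 < y) :
    (1 - ε) * (B : ℝ) * Real.log y ≤
      (α * B + ε) * (Real.log ((radical (y ^ B + 1) : ℕ) : ℝ) + β) := by
  have hyQ : (y : ℚ) ≠ 0 := by exact_mod_cast hy.ne'
  have hval : (1 : ℚ) * (y : ℚ) ^ B + 1 = ((y ^ B + 1 : ℕ) : ℚ) := by push_cast; ring
  have hne : (1 : ℚ) * (y : ℚ) ^ B + 1 ≠ 0 := by
    rw [hval]; exact_mod_cast Nat.succ_ne_zero (y ^ B)
  have h := hPL 1 (y : ℚ) one_ne_zero hyQ hne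
  have hnum : ((1 : ℚ) * (y : ℚ) ^ B + 1).num.natAbs = y ^ B + 1 := by
    rw [hval, Rat.num_natCast]
    rfl
  rw [hnum, logHeight₁_one] at h
  have hhy : logHeight₁ (y : ℚ) = Real.log y := by
    haveI : NeZero y := ⟨hy.ne'⟩; exact Rat.logHeight₁_natCast y
  rw [hhy] at h
  have hlow := soloInformed_mul_log_le_log_pow_succ hy B
  have e : (B : ℝ) * (α * 0 + ε * Real.log y) = ε * ((B : ℝ) * Real.log y) := by ring
  rw [e] at h
  nlinarith [h, hlow]

/-- **`PL ⟹ (PL₁)`.** Under Philippon's conjecture `PL` (`0 ≤ ε < 1/2`, `α ≥ 0`, any `β`, `B ≥ 1`) there are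
`λ > 0` and `C` with `λ · log y ≤ log rad(y^B + 1) + C` for every natural `y ≥ 1`: the radical of `y^B + 1`
grows like a fixed power of `y`. (`λ = (1 − ε)B/(αB + ε)`, `C = β`; if `αB + ε = 0` the hypothesis is
contradictory at `y = 2`.) [cite: Philippon2000Addendum, Conjecture, p. 167] -/
theorem soloInformed_PL1_of_philippon {ε α β : ℝ} {B : ℕ}
    (hε : 0 ≤ ε) (hε2 : ε < 1 / 2) (hα : 0 ≤ α) (hB : 0 < B)
    (hPL : ∀ x y : ℚ, x ≠ 0 → y ≠ 0 → x * y ^ B + 1 ≠ 0 →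
      Real.log (((x * y ^ B + 1).num.natAbs : ℕ) : ℝ) ≤
        (B : ℝ) * (α * logHeight₁ x + ε * logHeight₁ y) +
          (α * B + ε) *
            (Real.log ((radical (x * y ^ B + 1).num.natAbs : ℕ) : ℝ) + β)) :
    ∃ lam : ℝ, 0 < lam ∧ ∃ C : ℝ, ∀ y : ℕ, 0 < y →
      lam * Real.log y ≤ Real.log ((radical (y ^ B + 1) : ℕ) : ℝ) + C := by
  have hB0 : (0 : ℝ) < B := by exact_mod_cast hB
  by_cases hpos : 0 < α * B + ε
  · refine ⟨(1 - ε) * B / (α * B + ε), div_pos (by nlinarith) hpos, β, fun y hy => ?_⟩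
    have h := soloInformed_PL1_linear_of_philippon hPL hy
    rw [div_mul_eq_mul_div, div_le_iff₀ hpos]
    nlinarith [h]
  · -- degenerate parameters: `α = 0`, `ε = 0`; then `PL` at `x = 1, y = 2` says `B log 2 ≤ 0`.
    exfalso
    have hαB : 0 ≤ α * B := by positivity
    have hzero : α * B + ε = 0 := by linarith [not_lt.mp hpos]
    have h := soloInformed_PL1_linear_of_philippon hPL (y := 2) (by norm_num)
    rw [hzero, zero_mul] at h
    have hε0 : ε = 0 := by linarith
    rw [hε0] at h
    have hlog2 : 0 < Real.log (2 : ℕ) := by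
      rw [Nat.cast_ofNat]; exact Real.log_pos (by norm_num)
    nlinarith [h, hlog2]

/-! ### `ABC ⟹ (PL₁)` with Langevin's exponent -/

/-- **abc ⟹ `(PL₁)` (Langevin's consequence of abc for `t^B + 1`).** If the abc conjecture holds then
for every `B ≥ 1` and `ε > 0` there is `C` with `(B − 1 − ε) · log y ≤ (1 + ε) · log rad(y^B + 1) + C`
for all naturals `y ≥ 1`; for `B ≥ 2` and small `ε` this is `(PL₁)` with `λ = (B − 1 − ε)/(1 + ε)`.
Proof: the abc-triple `1 + y^B = y^B + 1` and `rad(1 · y^B · (y^B + 1)) ≤ y · rad(y^B + 1)`.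
[cite: Langevin1993] -/
theorem soloInformed_PL1_of_abc (hABC : ABC) {B : ℕ} (hB : 0 < B) {ε : ℝ} (hε : 0 < ε) :
    ∃ C : ℝ, ∀ y : ℕ, 0 < y →
      ((B : ℝ) - 1 - ε) * Real.log y ≤
        (1 + ε) * Real.log ((radical (y ^ B + 1) : ℕ) : ℝ) + C := by
  obtain ⟨K, hK0, hK⟩ := hABC ε hε
  refine ⟨Real.log K, fun y hy => ?_⟩
  -- the abc-triple (1, y^B, y^B + 1)
  have hyB : 0 < y ^ B := pow_pos hy B
  have htrip : IsABCTriple 1 (y ^ B) (y ^ B + 1) :=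
    ⟨Nat.one_pos, hyB, by ring, Nat.coprime_one_left _⟩
  have h := hK 1 (y ^ B) (y ^ B + 1) htrip
  -- radical bookkeeping
  have hrad_def : rad 1 (y ^ B) (y ^ B + 1) = radical (y ^ B * (y ^ B + 1)) := by
    show radical (1 * y ^ B * (y ^ B + 1)) = _
    rw [one_mul]
  have hrad_le : rad 1 (y ^ B) (y ^ B + 1) ≤ y * radical (y ^ B + 1) := by
    rw [hrad_def]; exact soloInformed_radical_pow_mul_succ_le hy hB
  have hR0 : (0 : ℝ) < ((rad 1 (y ^ B) (y ^ B + 1) : ℕ) : ℝ) := by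
    exact_mod_cast Nat.radical_pos _
  have hy0 : (0 : ℝ) < y := by exact_mod_cast hy
  have hr0 : (0 : ℝ) < ((radical (y ^ B + 1) : ℕ) : ℝ) := by exact_mod_cast Nat.radical_pos _
  have hc0 : (0 : ℝ) < ((y ^ B + 1 : ℕ) : ℝ) := by exact_mod_cast Nat.succ_pos _
  -- logarithms
  have hlogc : Real.log (((y ^ B + 1 : ℕ) : ℝ)) <
      Real.log K + (1 + ε) * Real.log ((rad 1 (y ^ B) (y ^ B + 1) : ℕ) : ℝ) := by
    have h1 : Real.log (((y ^ B + 1 : ℕ) : ℝ)) <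
        Real.log (K * ((rad 1 (y ^ B) (y ^ B + 1) : ℕ) : ℝ) ^ (1 + ε)) :=
      Real.log_lt_log hc0 (by exact_mod_cast h)
    rw [Real.log_mul hK0.ne' (Real.rpow_pos_of_pos hR0 _).ne', Real.log_rpow hR0] at h1
    exact h1
  have hlogR : Real.log (((rad 1 (y ^ B) (y ^ B + 1) : ℕ) : ℝ)) ≤
      Real.log y + Real.log ((radical (y ^ B + 1) : ℕ) : ℝ) := by
    rw [← Real.log_mul hy0.ne' hr0.ne']
    exact Real.log_le_log hR0 (by exact_mod_cast hrad_le)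
  have hlow := soloInformed_mul_log_le_log_pow_succ hy B
  have hε1 : 0 ≤ 1 + ε := by linarith
  nlinarith [hlogc, hlogR, hlow, mul_le_mul_of_nonneg_left hlogR hε1]

end Summit.ABC.ABC.Theorems
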